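import Literature.AlgebraicGeometry.ComplexMultiplication.EndomorphismFieldLieAlgebraDeterminantCondition
import Literature.AlgebraicGeometry.ComplexMultiplication.EndomorphismFieldDeterminantConditionDeterminesType
import Mathlib.FieldTheory.PrimitiveElement
import HarnessLib

/-!
# THE type `Φ` of Shimura's pair is determined by ONE characteristic polynomial: `char(ι(a) | Lie A)` at a
# primitive element `a` of `F/ℚ` — and by Kottwitz's determinant polynomial of a `ℚ`-basis on `Lie(A)`

Topic `Literature/AlgebraicGeometry/ComplexMultiplication` (family `hodge`, lane `lit-hodgefound`; the ALGEBRAIC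
carrier `Motives.AbelianVariety ℂ`, Shimura's pairs `(A, ι : F →+* A.endAlgebra)`, `[F : ℚ] = 2 dim A`, THE type
`Φ = cmTypeOfPair ι hF`).  Sequel of `EndomorphismFieldLieAlgebraSignature` (g26-#11: `char(ι(a) | Lie A) =
∏_{φ ∈ Φ} (X − φ(a))` for every `a ∈ F`) and of `EndomorphismFieldDeterminantConditionDeterminesType` (g26-#13:
Kottwitz's lemma «`V ≅ W` iff `det_V = det_W`» for `F ⊗ ℂ`).  The ONE-variable determinant condition at a single
generator already pins down `Φ`: distinct embeddings take distinct values at a primitive element, so the root set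
of `char(ι(a) | Lie A)` is `{φ(a) : φ ∈ Φ}` and `φ ↦ φ(a)` is injective.

PRINTED STATEMENTS.  B. Howard [Howard2012] §3.1 (held text `paper:arxiv-1303.0545` p. 19): «Note that this
condition implies that every `x ∈ 𝒪_K` acts on `Lie(A)` with characteristic polynomial `∏_{φ ∈ Φ} (T − φ(x))`»
(Def. 3.1.1, the stack `𝒞ℳ_Φ` of triples with «complex multiplication by `𝒪_K` and CM type `Φ`»).  R. Kottwitz
[Kottwitz1992] §5 p. 390: «`V` is isomorphic to `W` if and only if `det_V = det_W` … it is enough to prove the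
statement for `E = k × ⋯ × k`, in which case it is obvious.»  G. Shimura [Shimura1998] §5.2 p. 39 (the `ωᵢ`,
`δι(α)ωᵢ = α^{φᵢ}ωᵢ`), §8.4 (1).

WHAT IS PROVED (hypotheses `(ιF : F →+* A.endAlgebra) (hF : finrank ℚ F = 2 * A.dim)`,
`L(a) = Motives.AbelianVariety.lieAction A (ιF a)`):

* §1 (private) `apply_injective_of_adjoin_eq_top` — for `ℚ(a) = F`, `φ ↦ φ(a)` is injective on `Hom(F, ℂ)`;
  **`coe_eq_cmTypeOfPair_of_charpoly_lieAction_eq_prod`** — if `ℚ(a) = F` and `char(L(a)) = ∏_{ψ ∈ Ψ} (X − ψ(a))`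
  for a finite set `Ψ` of complex embeddings, then `Ψ = Φ`; **`charpoly_lieAction_eq_prod_iff`** (the `iff`);
  `exists_charpoly_lieAction_determines` — there IS such an `a` (Mathlib's primitive element theorem), so a single
  characteristic polynomial determines THE type.
* §2 «`V ≅ W` iff `det_V = det_W`» ON `Lie(A)` through the rational action (no lift): for a `ℚ`-spanning family /
  a `ℚ`-basis `β` of `F`, **`eq_indicator_of_det_sum_X_smul_toMatrix_lieAction_eq_prod_pow`** (the determinant
  polynomial `det(∑ᵢ Xᵢ [L(xᵢ)]_c) = ∏_φ ℓ_φ^{m_φ}` forces `m` = indicator of `Φ`) and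
  **`eq_cmTypeOfPair_of_det_sum_X_smul_toMatrix_lieAction_basis_eq_prod`** (`= ∏_{ψ ∈ Ψ} ℓ_ψ` forces `Ψ = Φ`) —
  Kottwitz's lemma of `EndomorphismFieldDeterminantConditionDeterminesType` composed with the Lie-algebra
  determinant condition of `EndomorphismFieldLieAlgebraDeterminantCondition`.

Theorems only; no definition, no named fact, no `sorry` (net debt 0); axioms `propext`, `Classical.choice`,
`Quot.sound`.

## References
* [Howard2012] B. Howard, *Complex multiplication cycles and Kudla–Rapoport divisors*, Ann. of Math. (2) 176 (2012),
  Def. 3.1.1 and §3.1.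
* [Kottwitz1992] R. E. Kottwitz, J. Amer. Math. Soc. 5 (1992), §5, p. 390.
* [Shimura1998] G. Shimura, *Abelian Varieties with Complex Multiplication and Modular Functions* (1998), §5.2 p. 39,
  §8.4 (1).

## Provenance

Lane `lit-hodgefound` (HOME `run/shared/lean/pub/lit-hodgefound/`), prover seat `lit-hodgefound-p11` (gen 26),
self-proposed row g26-#15 (INBOX claim 2026-08-27).
-/

noncomputable section

namespace Literature.AlgebraicGeometry.ComplexMultiplication

open scoped Classical Polynomial IntermediateField
open CategoryTheory NumberField Module Polynomial
open Literature.AlgebraicGeometry.Motives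
open Literature.NumberTheory.ComplexMultiplication

namespace EndFieldFullDegree

variable {F : Type} [Field F] [NumberField F] {A : AbelianVariety ℂ}
  (ιF : F →+* A.endAlgebra) (hF : finrank ℚ F = 2 * A.dim)

/-! ### §1 One characteristic polynomial at a primitive element determines `Φ` -/

/-- **Distinct complex embeddings take distinct values at a primitive element**: if `ℚ(a) = F` then
`φ ↦ φ(a)` is injective on `Hom(F, ℂ)`. [folklore] -/
private theorem apply_injective_of_adjoin_eq_top {a : F} (ha : ℚ⟮a⟯ = ⊤) :
    Function.Injective fun φ : F →+* ℂ => (φ a : ℂ) := by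
  intro φ ψ h
  have hadj : Algebra.adjoin ℚ {a} = ⊤ := by
    rw [← IntermediateField.adjoin_simple_toSubalgebra_of_isAlgebraic (Algebra.IsAlgebraic.isAlgebraic a), ha,
      IntermediateField.top_toSubalgebra]
  have halg : φ.toRatAlgHom = ψ.toRatAlgHom :=
    AlgHom.ext_of_adjoin_eq_top hadj fun y hy => by
      rw [Set.mem_singleton_iff.1 hy, RingHom.toRatAlgHom_apply, RingHom.toRatAlgHom_apply]
      exact h
  exact RingHom.equivRatAlgHom.injective halg

omit [NumberField F] in
/-- `∏_{σ ∈ S} (X − σ(a))` over a set of embeddings as a product over the image Finset of values. [folklore] -/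
private theorem prod_coe_X_sub_C_eq (S : Set (F →+* ℂ)) [Fintype (F →+* ℂ)] (a : F)
    (hinj : Function.Injective fun φ : F →+* ℂ => (φ a : ℂ)) :
    ∏ σ : S, (X - C (σ.1 a : ℂ)) = ∏ r ∈ S.toFinset.map ⟨fun φ : F →+* ℂ => (φ a : ℂ), hinj⟩, (X - C r) := by
  rw [Finset.prod_map, ← Finset.prod_subtype S.toFinset (fun φ => Set.mem_toFinset) (fun φ => X - C (φ a : ℂ))]
  rfl

include hF in
/-- **ONE CHARACTERISTIC POLYNOMIAL DETERMINES THE TYPE**: if `ℚ(a) = F` and `char(ι(a) | Lie A) =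
∏_{ψ ∈ Ψ} (X − ψ(a))` for a finite set `Ψ` of complex embeddings of `F`, then `Ψ = Φ = cmTypeOfPair ι hF` — the
roots of `char(ι(a) | Lie A)` are the DISTINCT numbers `φ(a)`, `φ ∈ Φ` («every `x` acts on `Lie(A)` with
characteristic polynomial `∏_{φ ∈ Φ}(T − φ(x))`», and `φ` is recovered from `φ(a)`).
[cite: Howard2012, §3.1 (display after Def. 3.1.1)] [cite: Kottwitz1992, §5 (p. 390)] -/
theorem coe_eq_cmTypeOfPair_of_charpoly_lieAction_eq_prod {a : F} (ha : ℚ⟮a⟯ = ⊤) {Ψ : Finset (F →+* ℂ)}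
    (h : (Motives.AbelianVariety.lieAction A (ιF a)).charpoly = ∏ ψ ∈ Ψ, (X - C (ψ a : ℂ))) :
    (Ψ : Set (F →+* ℂ)) = (cmTypeOfPair ιF hF).1 := by
  have hinj := apply_injective_of_adjoin_eq_top ha
  let ev : (F →+* ℂ) ↪ ℂ := ⟨fun φ : F →+* ℂ => (φ a : ℂ), hinj⟩
  have hΦ : (Motives.AbelianVariety.lieAction A (ιF a)).charpoly =
      ∏ r ∈ (cmTypeOfPair ιF hF).1.toFinset.map ev, (X - C r) := by
    rw [charpoly_lieAction_eq_prod ιF hF a, prod_coe_X_sub_C_eq _ a hinj]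
  have hΨ : ∏ ψ ∈ Ψ, (X - C (ψ a : ℂ)) = ∏ r ∈ Ψ.map ev, (X - C r) := by
    rw [Finset.prod_map]
    rfl
  have hroots := congrArg Polynomial.roots (hΦ.symm.trans (h.trans hΨ))
  rw [roots_prod_X_sub_C, roots_prod_X_sub_C, Finset.val_inj] at hroots
  have hsets : (cmTypeOfPair ιF hF).1.toFinset = Ψ := Finset.map_injective ev hroots
  rw [← hsets, Set.coe_toFinset]

include hF in
/-- **`char(ι(a) | Lie A) = ∏_{ψ ∈ Ψ} (X − ψ(a))` iff `Ψ = Φ`**, for `ℚ(a) = F`. [cite: Howard2012, §3.1]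
[cite: Kottwitz1992, §5 (p. 390)] -/
theorem charpoly_lieAction_eq_prod_iff {a : F} (ha : ℚ⟮a⟯ = ⊤) (Ψ : Finset (F →+* ℂ)) :
    (Motives.AbelianVariety.lieAction A (ιF a)).charpoly = ∏ ψ ∈ Ψ, (X - C (ψ a : ℂ)) ↔
      (Ψ : Set (F →+* ℂ)) = (cmTypeOfPair ιF hF).1 := by
  refine ⟨coe_eq_cmTypeOfPair_of_charpoly_lieAction_eq_prod ιF hF ha, fun hΨ => ?_⟩
  have hfin : (cmTypeOfPair ιF hF).1.toFinset = Ψ := by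
    rw [← Finset.coe_inj, Set.coe_toFinset, hΨ]
  rw [charpoly_lieAction_eq_prod ιF hF a, ← hfin,
    ← Finset.prod_subtype (cmTypeOfPair ιF hF).1.toFinset (fun φ => Set.mem_toFinset) (fun φ => X - C (φ a : ℂ))]

include hF in
/-- **A single characteristic polynomial determines THE type**: there is `a ∈ F` (any primitive element of `F/ℚ`)
such that for every finite set `Ψ` of embeddings, `char(ι(a) | Lie A) = ∏_{ψ ∈ Ψ} (X − ψ(a))` iff `Ψ = Φ`.
[cite: Howard2012, §3.1] [cite: Kottwitz1992, §5 (p. 390)] -/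
theorem exists_charpoly_lieAction_determines :
    ∃ a : F, ∀ Ψ : Finset (F →+* ℂ),
      (Motives.AbelianVariety.lieAction A (ιF a)).charpoly = ∏ ψ ∈ Ψ, (X - C (ψ a : ℂ)) ↔
        (Ψ : Set (F →+* ℂ)) = (cmTypeOfPair ιF hF).1 := by
  obtain ⟨a, ha⟩ := Field.exists_primitive_element ℚ F
  exact ⟨a, fun Ψ => charpoly_lieAction_eq_prod_iff ιF hF ha Ψ⟩

/-! ### §2 «`V ≅ W` iff `det_V = det_W`» on `Lie(A)`: the determinant polynomial of a basis determines `Φ` -/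

omit [NumberField F] in
/-- A product over a set of embeddings as a product of indicator powers over all embeddings. [folklore] -/
private theorem prod_coe_eq_prod_pow_ite' {ι : Type} (S : Set (F →+* ℂ)) [Fintype (F →+* ℂ)]
    (f : (F →+* ℂ) → MvPolynomial ι ℂ) :
    ∏ σ : S, f σ.1 = ∏ φ, f φ ^ (if φ ∈ S then 1 else 0) := by
  rw [← Finset.prod_subtype (Finset.univ.filter (· ∈ S)) (by simp) f, Finset.prod_filter]
  refine Finset.prod_congr rfl fun φ _ => ?_
  split_ifs <;> simp

/-- **Multiplicity form**: if for a `ℚ`-spanning family `x` of `F` and a basis `c` of `Lie(A)` the determinant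
polynomial `det(∑ᵢ Xᵢ [L(xᵢ)]_c)` equals `∏_φ (∑ᵢ Xᵢ φ(xᵢ))^{m_φ}`, then `m` is the indicator of `Φ`.
[cite: Kottwitz1992, §5 (p. 390)] [cite: Howard2012, Def. 3.1.1] -/
theorem eq_indicator_of_det_sum_X_smul_toMatrix_lieAction_eq_prod_pow {ι : Type} [Fintype ι] {x : ι → F}
    (hx : Submodule.span ℚ (Set.range x) = ⊤) {n : Type} [Fintype n] [DecidableEq n]
    (c : Basis n ℂ (Motives.AbelianVariety.Lie A)) {m : (F →+* ℂ) → ℕ}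
    (h : (∑ i, (MvPolynomial.X i : MvPolynomial ι ℂ) •
        ((LinearMap.toMatrix c c (Motives.AbelianVariety.lieAction A (ιF (x i)))).map MvPolynomial.C :
          Matrix n n (MvPolynomial ι ℂ))).det =
      ∏ φ : F →+* ℂ, (∑ i, (MvPolynomial.X i : MvPolynomial ι ℂ) * MvPolynomial.C (φ (x i) : ℂ)) ^ m φ) :
    m = fun φ => if φ ∈ (cmTypeOfPair ιF hF).1 then 1 else 0 := by
  rw [det_sum_X_smul_toMatrix_lieAction_eq_prod ιF hF x c,
    prod_coe_eq_prod_pow_ite' (cmTypeOfPair ιF hF).1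
      (fun φ => ∑ i, (MvPolynomial.X i : MvPolynomial ι ℂ) * MvPolynomial.C (φ (x i) : ℂ))] at h
  exact (eq_of_prod_linearForm_pow_eq x hx h).symm

/-- **«`V` is isomorphic to `W` if and only if `det_V = det_W`» ON SHIMURA'S PAIR**: if for a `ℚ`-basis `β` of `F`
the determinant of `X₁β₁ + ⋯ + X_tβ_t` on `Lie(A)` is `∏_{ψ ∈ Ψ} (∑ᵢ Xᵢ ψ(βᵢ))` for a set `Ψ` of complex
embeddings, then `Ψ = Φ` — the `F ⊗ ℂ`-module `Lie(A) ≅ ⊕_{φ ∈ Φ} ℂ_φ` is determined by its determinant polynomial.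
[cite: Kottwitz1992, §5 (p. 390)] [cite: Howard2012, Def. 3.1.1] -/
theorem eq_cmTypeOfPair_of_det_sum_X_smul_toMatrix_lieAction_basis_eq_prod {ι : Type} [Fintype ι]
    (β : Basis ι ℚ F) {n : Type} [Fintype n] [DecidableEq n] (c : Basis n ℂ (Motives.AbelianVariety.Lie A))
    {Ψ : Set (F →+* ℂ)}
    (h : (∑ i, (MvPolynomial.X i : MvPolynomial ι ℂ) •
        ((LinearMap.toMatrix c c (Motives.AbelianVariety.lieAction A (ιF (β i)))).map MvPolynomial.C :
          Matrix n n (MvPolynomial ι ℂ))).det =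
      ∏ σ : Ψ, (∑ i, (MvPolynomial.X i : MvPolynomial ι ℂ) * MvPolynomial.C (σ.1 (β i) : ℂ))) :
    Ψ = (cmTypeOfPair ιF hF).1 := by
  rw [prod_coe_eq_prod_pow_ite' Ψ
    (fun φ => ∑ i, (MvPolynomial.X i : MvPolynomial ι ℂ) * MvPolynomial.C (φ (β i) : ℂ))] at h
  have hm := eq_indicator_of_det_sum_X_smul_toMatrix_lieAction_eq_prod_pow ιF hF β.span_eq c h
  ext φ
  have hφ : (if φ ∈ Ψ then (1 : ℕ) else 0) = if φ ∈ (cmTypeOfPair ιF hF).1 then 1 else 0 := congrFun hm φ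
  constructor
  · intro h1
    by_contra h2
    rw [if_pos h1, if_neg h2] at hφ
    exact one_ne_zero hφ
  · intro h2
    by_contra h1
    rw [if_neg h1, if_pos h2] at hφ
    exact zero_ne_one hφ

end EndFieldFullDegree

end Literature.AlgebraicGeometry.ComplexMultiplication

end
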